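import Literature.AnabelianGeometry.AbsoluteAnabelian.AbsAnabStarConditionSplitCompletion
import Literature.AnabelianGeometry.AbsoluteAnabelian.HatZSigmaPowCompletion
import Literature.AnabelianGeometry.AbsoluteAnabelian.AbsTopIThm26SplitModelInstances
import Literature.AnabelianGeometry.SemiGraphs.FreeProPRankTwo
import HarnessLib

/-!
# [AbsTopI] Thm 2.6 (ii): condition (∗)_Σ AT THE PRO-`Σ` SPLIT MODEL `Π = Γ̂^Σ × G ↠ G` WITH
# NON-ABELIAN `Δ`, for EVERY prime set `Σ`

S. Mochizuki, *Topics in Absolute Anabelian Geometry I* (2012) [AbsTopI], Thm 2.6 (ii), proof p. 23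
("`Q_l := Q ⊗ ℤ_l` … the `ℤ_l`-ranks of `R_l`, `Q_l` are independent of `l ∈ Σ`"), typed by
abc-iut-w6-d074 as the hypothesis predicate `FundamentalExtension.SigmaStarCondition Σ`
(`AbsTopIThm26iiSigmaStar.lean`): for every open `Π″ ⊆ Π`, `Δ″/coinvRadical Π″ ≅ Ẑ_Σ^m` — the
`Σ`-version of [AbsAnab] Lemma 1.1.4 (ii) (∗).  Instances in the tree so far: `Δ = 1` (`m = 0`) and
abc-iut-w5-d188's `Δ ≅ Ẑ^Σ` central (`m = 1`).

This PROOF-ONLY file (no definition, no instance, no named fact; abc-iut cell, block F seat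
abc-iut-f-090 gen 3, row «STAR-SPLIT-NONABELIAN»-Σ) proves (∗)_Σ at the split extension
`1 → Γ̂^Σ → Γ̂^Σ × G → G → 1` for `Γ̂^Σ` ANY pro-`Σ` completion (`IsProSigmaCompletion Σ`) of ANY finitely
generated group `Γ` (e.g. the free pro-`Σ` groups `F̂_n^Σ`, the pro-`Σ` surface groups of [IUTchI]) and
`G` ANY profinite group, at EVERY open `Π″`, for EVERY `Σ`:

* **`sigmaStarCondition_split_of_isProSigmaCompletion`** — verbatim the mechanism of
  `starCondition_split_of_isProSigmaCompletion` (`AbsAnabStarConditionSplitCompletion.lean`: Schreier,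
  the discrete engine `Literature.GroupTheory.CoinvariantFreeQuotient`, abc-iut-L3's
  `IsProSigmaCompletion.restrict` / `quotientMap` / `exists_continuousMulEquiv`, radical = closure of
  `ι(ker q₀)`), with the target `Ẑ^m` replaced by `Ẑ_Σ^m = HatZSigmaPow Σ m`, which IS the pro-`Σ`
  completion of `ℤ^m` (`HatZSigmaPow.isProSigmaCompletion_cast`, this seat's `HatZSigmaPowCompletion.lean`)
  and is torsion-free (`HatZSigmaPow.eq_one_of_pow_eq_one`).

HONEST LABEL: split model = trivial outer action — a satisfiability witness of the typed (∗)_Σ with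
NON-ABELIAN `Δ`, NOT the extension of a curve.  [AbsTopI] is refereed; nothing here bears on [IUTchIII]
Cor. 3.12 or takes a side; typed ≠ proved elsewhere.  Theorems only; axioms standard.
-/

noncomputable section

open Topology Field
open scoped commutatorElement

namespace Literature.AnabelianGeometry.AbsoluteAnabelian

open Literature.AnabelianGeometry.SemiGraphs.SemiGraphOfAnabelioids
open Literature.AnabelianGeometry.SemiGraphs.SemiGraphOfAnabelioids (IsProSigmaCompletion)
open Literature.IUT.HodgeTheaters (profiniteCompletion toCompletion)
open Literature.GroupTheory.CoinvariantFreeQuotient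

universe u

namespace FundamentalExtension

section Main

variable (S : Set ℕ) (Δ G : ProfiniteGrp.{0}) {Γ : Type u} [Group Γ] [Group.FG Γ] {ι : Γ →* Δ}

/-- **[AbsTopI] Thm 2.6 (ii), condition (∗)_Σ (`SigmaStarCondition Σ`), AT THE PRO-`Σ` SPLIT MODEL
`Π = Γ̂^Σ × G ↠ G`** — `Γ̂^Σ` a pro-`Σ` completion of a finitely generated group `Γ` (NON-ABELIAN `Δ`
allowed), `G` any profinite group, `Σ` ANY set: for every open `Π″ ⊆ Π` there are `m` and a continuous
surjection `Δ″ ↠ Ẑ_Σ^m` with kernel exactly `coinvRadical Π″`.  HONEST LABEL: trivial outer action.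
[cite: MochizukiAbsTopI2012, Thm 2.6 (ii) proof p.23] -/
theorem sigmaStarCondition_split_of_isProSigmaCompletion (hι : IsProSigmaCompletion S ι) :
    (⟨ProfiniteGrp.of (Δ × G), G, ContinuousMonoidHom.snd Δ G, Prod.snd_surjective⟩ :
      FundamentalExtension.{0}).SigmaStarCondition S := by
  classical
  set E : FundamentalExtension.{0} :=
    ⟨ProfiniteGrp.of (Δ × G), G, ContinuousMonoidHom.snd Δ G, Prod.snd_surjective⟩ with hE
  intro P hP
  have hmem : ∀ x : Δ × G, (x : E.arith) ∈ E.geom ↔ x.2 = 1 := fun _ => Iff.rfl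
  /- (1) the open subgroups `W = {x | (x,1) ∈ Π″}` and `A₀ = pr₁ Π″` of `Γ̂` -/
  set W : Subgroup Δ := (P : Subgroup (Δ × G)).comap (MonoidHom.inl Δ G) with hW
  set A₀ : Subgroup Δ := (P : Subgroup (Δ × G)).map (MonoidHom.fst Δ G) with hA₀
  have hWo : IsOpen (W : Set Δ) := isOpen_comap_inl hP
  have hA₀o : IsOpen (A₀ : Set Δ) := isOpen_map_fst hP
  have hWA : W ≤ A₀ := comap_inl_le_map_fst _
  have hmemW : ∀ x : Δ, x ∈ W ↔ ((x, 1) : Δ × G) ∈ (P : Subgroup (Δ × G)) := fun _ => Iff.rfl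
  haveI : CompactSpace W := isCompact_iff_compactSpace.mp (W.isClosed_of_isOpen hWo).isCompact
  /- (2) the discrete side: `U = ι⁻¹ W` (finite index, finitely generated), normalised by `D = ι⁻¹ A₀` -/
  set U : Subgroup Γ := W.comap ι with hU
  set D : Subgroup Γ := A₀.comap ι with hD
  have hUD : U ≤ D := Subgroup.comap_mono hWA
  have hn : ∀ d ∈ D, ∀ u ∈ U, d * u * d⁻¹ ∈ U := fun d hd u hu => by
    change ι (d * u * d⁻¹) ∈ W
    rw [map_mul, map_mul, map_inv]
    exact conj_mem_comap_inl hd hu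
  haveI : U.FiniteIndex := hι.finiteIndex_comap W hWo
  obtain ⟨m, q, hqs, hqD, hqker⟩ := exists_coinvariant_free_quotient_of_finiteIndex D U hUD hn
  /- (3) `W` is the completion of `U`; the closure `N` of `ι(ker q)` and the completion
  `U / ker q → W / N`, identified with `ℤ^m → Ẑ^m` -/
  set ιU : U →* W := ι.subgroupComap W with hιU
  have hιU_coe : ∀ u : U, ((ιU u : W) : Δ) = ι u := fun _ => rfl
  have hιW : IsProSigmaCompletion S ιU := hι.restrict W hWo
  set K₀ : Subgroup U := q.ker with hK₀
  set N : Subgroup W := (K₀.map ιU).topologicalClosure with hN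
  have hNcoe : (N : Set W) = closure (ιU '' (K₀ : Set U)) := by
    rw [hN, Subgroup.topologicalClosure_coe, Subgroup.coe_map]
  haveI hNn : N.Normal := IsProSigmaCompletion.normal_of_coe_eq_closure_image hιW.dense K₀ N hNcoe
  have hNc : IsClosed (N : Set W) := Subgroup.isClosed_topologicalClosure _
  haveI : TotallyDisconnectedSpace (W ⧸ N) :=
    Literature.GroupTheory.ProfiniteSubquotients.totallyDisconnectedSpace_quotient N hNc
  have hquot : IsProSigmaCompletion S
      (QuotientGroup.map K₀ N ιU (IsProSigmaCompletion.le_comap_of_image_subset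
        (IsProSigmaCompletion.image_subset_of_coe_eq_closure hNcoe))) :=
    IsProSigmaCompletion.quotientMap_of_coe_eq_closure hιW K₀ N hNcoe
  set eL : U ⧸ K₀ ≃* Multiplicative (Fin m → ℤ) :=
    QuotientGroup.quotientKerEquivOfSurjective q hqs with heL
  set κS : Multiplicative (Fin m → ℤ) →* HatZSigmaPow S m := AddMonoidHom.toMultiplicative
    ((Int.castAddHom (∀ l : {l : ℕ // l.Prime ∧ l ∈ S}, @PadicInt l.1 ⟨l.2.1⟩)).compLeft (Fin m))
    with hκS_def
  set κ : U ⧸ K₀ →* HatZSigmaPow S m := κS.comp eL.toMonoidHom with hκ_def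
  have hκ : IsProSigmaCompletion S κ :=
    IsProSigmaCompletion.of_comp_mulEquiv eL (fun _ => rfl)
      (HatZSigmaPow.isProSigmaCompletion_cast S m)
  obtain ⟨e, he⟩ := hquot.exists_continuousMulEquiv hκ
  /- (4) the continuous surjection `qW : W ↠ Ẑ^m` with kernel `N`, extending `q` -/
  set qW : W →* HatZSigmaPow S m := e.toMulEquiv.toMonoidHom.comp (QuotientGroup.mk' N) with hqW
  have hqW_apply : ∀ w : W, qW w = e (QuotientGroup.mk' N w) := fun _ => rfl
  have hqWc : Continuous qW := e.continuous.comp QuotientGroup.continuous_mk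
  have hqWs : Function.Surjective qW := e.surjective.comp (QuotientGroup.mk'_surjective N)
  have hqWker : ∀ w : W, qW w = 1 ↔ w ∈ N := fun w => by
    rw [hqW_apply, EmbeddingLike.map_eq_one_iff, QuotientGroup.mk'_apply,
      QuotientGroup.eq_one_iff]
  have hqWι : ∀ u : U, qW (ιU u) = κS (q u) := fun u => by
    rw [hqW_apply, QuotientGroup.mk'_apply]
    have h1 : (QuotientGroup.mk (ιU u) : W ⧸ N) =
        QuotientGroup.map K₀ N ιU (IsProSigmaCompletion.le_comap_of_image_subset
          (IsProSigmaCompletion.image_subset_of_coe_eq_closure hNcoe)) (QuotientGroup.mk u) := by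
      rw [QuotientGroup.map_mk]
    rw [h1, he]
    rfl
  /- (5) `qW` is invariant under conjugation by `A₀ = pr₁ Π″` (density of `ι(D)` in `A₀`, of `ι(U)` in `W`) -/
  have hconjW : ∀ {a : Δ}, a ∈ A₀ → ∀ w : W, (a * (w : Δ) * a⁻¹) ∈ W := fun ha w =>
    conj_mem_comap_inl ha w.2
  have hinv : ∀ (a : A₀) (w : W), qW ⟨(a : Δ) * w * (a : Δ)⁻¹, hconjW a.2 w⟩ = qW w := by
    -- (i) on `ι(D) × ι(U)` this is the `D`-invariance of `q`
    have hDU : ∀ (d : D) (u : U),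
        qW ⟨ι (d : Γ) * (ιU u : W) * (ι (d : Γ))⁻¹, hconjW d.2 (ιU u)⟩ = qW (ιU u) := by
      intro d u
      have h1 : (⟨ι (d : Γ) * (ιU u : W) * (ι (d : Γ))⁻¹, hconjW d.2 (ιU u)⟩ : W) =
          ιU ⟨(d : Γ) * (u : Γ) * (d : Γ)⁻¹, hn d d.2 u u.2⟩ := by
        apply Subtype.ext
        change ι (d : Γ) * ι (u : Γ) * (ι (d : Γ))⁻¹ = ι ((d : Γ) * (u : Γ) * (d : Γ)⁻¹)
        rw [map_mul, map_mul, map_inv]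
      rw [h1, hqWι, hqWι]
      exact congrArg _ (hqD (d : Γ) d.2 u)
    -- (ii) density of `ι(D)` in `A₀`, for fixed `u`
    have hAU : ∀ (a : A₀) (u : U),
        qW ⟨(a : Δ) * (ιU u : W) * (a : Δ)⁻¹, hconjW a.2 (ιU u)⟩ = qW (ιU u) := by
      intro a u
      have hdense : Dense (Set.range (ι.subgroupComap A₀)) :=
        IsProSigmaCompletion.dense_range_subgroupComap hι A₀ hA₀o
      let f : A₀ → HatZSigmaPow S m := fun a => qW ⟨(a : Δ) * (ιU u : W) * (a : Δ)⁻¹, hconjW a.2 (ιU u)⟩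
      have hf : Continuous f := by
        refine hqWc.comp (Continuous.subtype_mk ?_ _)
        exact ((continuous_subtype_val.mul continuous_const).mul continuous_subtype_val.inv)
      have hS : IsClosed {a : A₀ | f a = qW (ιU u)} := isClosed_eq hf continuous_const
      have hsub : Set.range (ι.subgroupComap A₀) ⊆ {a : A₀ | f a = qW (ιU u)} := by
        rintro _ ⟨d, rfl⟩
        exact hDU d u
      have huniv : {a : A₀ | f a = qW (ιU u)} = Set.univ := by
        rw [← hS.closure_eq]
        exact (hdense.mono hsub).closure_eq
      have ha : a ∈ {a : A₀ | f a = qW (ιU u)} := by rw [huniv]; exact Set.mem_univ a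
      exact ha
    -- (iii) density of `ι(U)` in `W`, for fixed `a`
    intro a
    let g₁ : W → HatZSigmaPow S m := fun w => qW ⟨(a : Δ) * w * (a : Δ)⁻¹, hconjW a.2 w⟩
    have hg₁ : Continuous g₁ := by
      refine hqWc.comp (Continuous.subtype_mk ?_ _)
      exact ((continuous_const.mul continuous_subtype_val).mul continuous_const)
    have heq : g₁ = qW := Continuous.ext_on hιW.dense hg₁ hqWc (by
      rintro _ ⟨u, rfl⟩
      exact hAU a u)
    intro w
    exact congrFun heq w
  /- (6) transport to `Δ″ = Δ ⊓ Π″ ⊆ Π` along `t : W ≃ₜ* Δ″`, `x ↦ (x, 1)` -/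
  have hy2 : ∀ y : ↥(E.geom ⊓ P), ((y : E.arith) : Δ × G).2 = 1 := fun y =>
    (hmem _).mp (Subgroup.mem_inf.mp y.2).1
  have hyW : ∀ y : ↥(E.geom ⊓ P), ((y : E.arith) : Δ × G).1 ∈ W := fun y => by
    rw [hmemW, show ((((y : E.arith) : Δ × G).1, 1) : Δ × G) = ((y : E.arith) : Δ × G) from
      Prod.ext rfl (hy2 y).symm]
    exact (Subgroup.mem_inf.mp y.2).2
  let t : W ≃ₜ* ↥(E.geom ⊓ P) :=
    { toFun := fun x => ⟨((((x : Δ), (1 : G)) : Δ × G) : E.arith),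
        Subgroup.mem_inf.mpr ⟨(hmem _).mpr rfl, x.2⟩⟩
      invFun := fun y => ⟨((y : E.arith) : Δ × G).1, hyW y⟩
      left_inv := fun x => rfl
      right_inv := fun y => Subtype.ext (Prod.ext rfl (hy2 y).symm)
      map_mul' := fun x y => Subtype.ext (Prod.ext rfl (mul_one (1 : G)).symm)
      continuous_toFun := ((continuous_subtype_val.prodMk continuous_const)).subtype_mk _
      continuous_invFun := (continuous_fst.comp continuous_subtype_val).subtype_mk _ }
  have ht_apply : ∀ x : W, ((t x : ↥(E.geom ⊓ P)) : E.arith) = ((((x : Δ), (1 : G)) : Δ × G) : E.arith) :=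
    fun _ => rfl
  have ht_symm_coe : ∀ y : ↥(E.geom ⊓ P), ((t.symm y : W) : Δ) = ((y : E.arith) : Δ × G).1 :=
    fun _ => rfl
  let Q : ↥(E.geom ⊓ P) →ₜ* HatZSigmaPow S m :=
    ContinuousMonoidHom.mk (qW.comp t.symm.toMulEquiv.toMonoidHom) (hqWc.comp t.symm.continuous)
  have hQ_apply : ∀ y, Q y = qW (t.symm y) := fun _ => rfl
  have hQs : Function.Surjective Q := hqWs.comp t.symm.surjective
  -- the image `R ⊆ Π` of `N`
  set R : Subgroup E.arith := (N.map t.toMulEquiv.toMonoidHom).map (E.geom ⊓ P).subtype with hR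
  have hmemR : ∀ y : ↥(E.geom ⊓ P), (y : E.arith) ∈ R ↔ t.symm y ∈ N := by
    intro y
    rw [hR, Subgroup.mem_map]
    constructor
    · rintro ⟨y', hy', hyy'⟩
      rw [Subgroup.mem_map] at hy'
      obtain ⟨w, hw, rfl⟩ := hy'
      have : t w = y := Subtype.ext hyy'
      rw [← this]
      change t.symm (t w) ∈ N
      rwa [t.symm_apply_apply]
    · intro hy
      refine ⟨t (t.symm y), Subgroup.mem_map.mpr ⟨t.symm y, hy, rfl⟩, ?_⟩
      rw [t.apply_symm_apply]
      rfl
  have hQR : ∀ y : ↥(E.geom ⊓ P), Q y = 1 ↔ (y : E.arith) ∈ R := fun y => by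
    rw [hQ_apply, hqWker, hmemR]
  -- conjugation invariance of `Q` under `Π″`
  have hQconj : ∀ (π : E.arith) (hπ : π ∈ P) (y : ↥(E.geom ⊓ P)),
      Q ⟨π * y * π⁻¹, Subgroup.mem_inf.mpr ⟨E.normal_geom.conj_mem _ (Subgroup.mem_inf.mp y.2).1 π,
        P.mul_mem (P.mul_mem hπ (Subgroup.mem_inf.mp y.2).2) (P.inv_mem hπ)⟩⟩ = Q y := by
    intro π hπ y
    have ha : ((π : Δ × G).1) ∈ A₀ := ⟨π, hπ, rfl⟩
    rw [hQ_apply, hQ_apply, ← hinv ⟨(π : Δ × G).1, ha⟩ (t.symm y)]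
    congr 1
  /- (7) `R` is the radical `coinvRadical Π″` -/
  have hrad : E.coinvRadical P = R := by
    apply le_antisymm
    · -- `R` belongs to the defining family of the radical
      unfold FundamentalExtension.coinvRadical
      refine sInf_le ⟨?_, ?_, ?_, ?_, ?_⟩
      · rintro _ ⟨y, _, rfl⟩
        exact y.2
      · -- closed: the image of the compact `N` under the continuous `W → Π`
        have hReq : (R : Set E.arith) =
            (fun w : W => ((t w : ↥(E.geom ⊓ P)) : E.arith)) '' (N : Set W) := by
          rw [hR, Subgroup.coe_map, Subgroup.coe_map, Set.image_image]
          rfl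
        rw [hReq]
        exact (hNc.isCompact.image (continuous_subtype_val.comp t.continuous)).isClosed
      · -- normal in `Δ″`
        have hsub : R.subgroupOf (E.geom ⊓ P) = N.map t.toMulEquiv.toMonoidHom := by
          rw [hR, ← Subgroup.comap_subtype]
          exact Subgroup.comap_map_eq_self_of_injective (E.geom ⊓ P).subtype_injective _
        rw [hsub]
        exact hNn.map _ t.surjective
      · -- root-closed: `Ẑ^m` is torsion-free
        intro x hx n hn0 hxn
        have hxn' : Q (⟨x, hx⟩ ^ n) = 1 := (hQR _).mpr hxn
        rw [map_pow] at hxn'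
        exact (hQR ⟨x, hx⟩).mp (HatZSigmaPow.eq_one_of_pow_eq_one S m hn0.ne' hxn')
      · -- contains the commutators `[π, δ]`
        intro π hπ δ hδ
        have hmem' : π * δ * π⁻¹ ∈ E.geom ⊓ P :=
          Subgroup.mem_inf.mpr ⟨E.normal_geom.conj_mem _ (Subgroup.mem_inf.mp hδ).1 π,
            P.mul_mem (P.mul_mem hπ (Subgroup.mem_inf.mp hδ).2) (P.inv_mem hπ)⟩
        have h1 : Q (⟨π * δ * π⁻¹, hmem'⟩ * ⟨δ, hδ⟩⁻¹) = 1 := by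
          rw [map_mul, map_inv, hQconj π hπ ⟨δ, hδ⟩, mul_inv_cancel]
        exact (hQR _).mp h1
    · -- `R` is contained in every member `B` of the family
      refine le_sInf ?_
      rintro B ⟨-, hBc, -, hBr, hBcomm⟩
      -- pull `B` back to `W`
      let B' : Subgroup W := (B.comap (E.geom ⊓ P).subtype).comap t.toMulEquiv.toMonoidHom
      have hB'c : IsClosed (B' : Set W) :=
        hBc.preimage (continuous_subtype_val.comp t.continuous)
      have hmemB' : ∀ w : W, w ∈ B' ↔ ((((w : Δ), (1 : G)) : Δ × G) : E.arith) ∈ B :=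
        fun _ => Iff.rfl
      -- `ι⁅D, U⁆ × 1 ⊆ B`: generators are commutators `[π, δ]` with `π ∈ Π″`, `δ ∈ Δ″`
      have hcomm : ∀ c ∈ (⁅D, U⁆ : Subgroup Γ), (((ι c, (1 : G)) : Δ × G) : E.arith) ∈ B := by
        intro c hc
        rw [Subgroup.commutator_def] at hc
        induction hc using Subgroup.closure_induction with
        | mem x hx =>
          obtain ⟨d, hd, u', hu', rfl⟩ := hx
          obtain ⟨y, hy, hyd⟩ := hd
          have hu'P : (((ι u', (1 : G)) : Δ × G) : E.arith) ∈ E.geom ⊓ P :=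
            Subgroup.mem_inf.mpr ⟨(hmem _).mpr rfl, hu'⟩
          have h := hBcomm y hy _ hu'P
          have heq : (y : Δ × G) * (ι u', 1) * (y : Δ × G)⁻¹ * (ι u', 1)⁻¹ = (ι ⁅d, u'⁆, 1) := by
            rw [commutatorElement_def, map_mul, map_mul, map_mul, map_inv, map_inv]
            refine Prod.ext ?_ ?_
            · change (y : Δ × G).1 * ι u' * (y : Δ × G).1⁻¹ * (ι u')⁻¹ = ι d * ι u' * (ι d)⁻¹ * (ι u')⁻¹
              rw [← show (y : Δ × G).1 = ι d from hyd]
            · change (y : Δ × G).2 * 1 * (y : Δ × G).2⁻¹ * 1⁻¹ = 1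
              rw [mul_one, mul_inv_cancel, inv_one, mul_one]
          exact heq ▸ h
        | one =>
          rw [map_one]
          exact B.one_mem
        | mul x x' _ _ ihx ihx' =>
          have heq : (((ι (x * x'), (1 : G)) : Δ × G) : E.arith) =
              (((ι x, (1 : G)) : Δ × G) : E.arith) * (((ι x', (1 : G)) : Δ × G) : E.arith) := by
            rw [map_mul]
            exact Prod.ext rfl (mul_one (1 : G)).symm
          rw [heq]
          exact B.mul_mem ihx ihx'
        | inv x _ ih =>
          have heq : (((ι x⁻¹, (1 : G)) : Δ × G) : E.arith) =
              (((ι x, (1 : G)) : Δ × G) : E.arith)⁻¹ := by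
            rw [map_inv]
            exact Prod.ext rfl inv_one.symm
          rw [heq]
          exact B.inv_mem ih
      -- hence `ι(ker q) × 1 ⊆ B` (root-closedness of `B`)
      have hK₀B : K₀.map ιU ≤ B' := by
        rintro _ ⟨u, hu, rfl⟩
        rw [hmemB']
        obtain ⟨n, hn0, hun⟩ := (hqker u).mp hu
        refine hBr _ (Subgroup.mem_inf.mpr ⟨(hmem _).mpr rfl, (ιU u).2⟩) n hn0 ?_
        have heq : (((((ιU u : W) : Δ), (1 : G)) : Δ × G) : E.arith) ^ n =
            (((ι ((u : Γ) ^ n), (1 : G)) : Δ × G) : E.arith) := by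
          rw [map_pow]
          exact Prod.ext rfl (one_pow n)
        rw [heq]
        exact hcomm _ hun
      have hNB : N ≤ B' := (K₀.map ιU).topologicalClosure_minimal hK₀B hB'c
      rintro _ ⟨y', hy', rfl⟩
      obtain ⟨w, hw, rfl⟩ := Subgroup.mem_map.mp hy'
      exact (hmemB' w).mp (hNB hw)
  /- (8) conclusion -/
  refine ⟨m, Q, hQs, fun y => ?_⟩
  rw [hrad]
  exact hQR y

end Main

/-! ### Instances: the free pro-`p` group of rank two, `Σ = {p}` -/

section Instances

open Literature.AnabelianGeometry.SemiGraphs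

/-- **(∗)_{p} at `F̂₂⁽ᵖ⁾ × G ↠ G`** — `F̂₂⁽ᵖ⁾` abc-iut-L3's concrete free pro-`p` group of rank two (the
pro-`p` completion of `F₂`, NON-ABELIAN), `G` any profinite group, `Σ = {p}`: unconditional.
[cite: MochizukiAbsTopI2012, Thm 2.6 (ii) proof p.23] -/
theorem sigmaStarCondition_split_freeProPTwo (p : ℕ) (G : ProfiniteGrp.{0}) :
    (⟨ProfiniteGrp.of (FreeProPRankTwo.Grp p × G), G,
        ContinuousMonoidHom.snd (FreeProPRankTwo.Grp p) G, Prod.snd_surjective⟩ :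
      FundamentalExtension.{0}).SigmaStarCondition ({p} : Set ℕ) :=
  sigmaStarCondition_split_of_isProSigmaCompletion {p} (FreeProPRankTwo.Grp p) G
    (FreeProPRankTwo.isProSigmaCompletion_ι p)

/-- **Non-vacuity of (∗)_Σ WITH NON-ABELIAN `Δ`, `Σ = {p}`**: over every MLF base `(ℓ, K)` there is an
extension with MLF base data whose `Δ` is topologically finitely generated and NON-COMMUTATIVE
(`Δ ≅ F̂₂⁽ᵖ⁾`, its two generators do not commute), which splits over an open subgroup and satisfies
`SigmaStarCondition {p}` at every open `Π″` — namely `F̂₂⁽ᵖ⁾ × G_K ↠ G_K`.  HONEST LABEL: trivial outer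
action, not a curve's extension. [cite: MochizukiAbsTopI2012, Thm 2.6 (ii) proof p.23] -/
theorem exists_mlfBase_sigmaStar_nonabelian (p : ℕ) [Fact p.Prime] (ℓ : ℕ) [Fact ℓ.Prime] (K : Type)
    [Field K] [CharZero K] [Algebra ℚ_[ℓ] K] [FiniteDimensional ℚ_[ℓ] K] :
    ∃ E : FundamentalExtension.{0}, Nonempty E.MLFBase ∧
      (∃ a ∈ E.geom, ∃ b ∈ E.geom, a * b ≠ b * a) ∧ IsTopologicallyFinitelyGenerated E.geom ∧
      E.SplitsOverOpenSubgroup ∧ E.SigmaStarCondition ({p} : Set ℕ) := by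
  let Fp := FreeProPRankTwo.Grp p
  let E : FundamentalExtension.{0} :=
    ⟨ProfiniteGrp.of (Fp × absoluteGaloisGroup K), absoluteGaloisGrp K,
      ContinuousMonoidHom.snd Fp (absoluteGaloisGroup K), Prod.snd_surjective⟩
  have hmem : ∀ x : Fp × absoluteGaloisGroup K, (x : E.arith) ∈ E.geom ↔ x.2 = 1 := fun _ => Iff.rfl
  refine ⟨E, ⟨{ p := ℓ, K := K, galIso := ContinuousMulEquiv.refl _ }⟩, ?_, ?_,
    splitsOverOpenSubgroup_split Fp (absoluteGaloisGrp K),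
    sigmaStarCondition_split_of_isProSigmaCompletion {p} Fp (absoluteGaloisGrp K)
      (FreeProPRankTwo.isProSigmaCompletion_ι p)⟩
  · refine ⟨((FreeProPRankTwo.a p, 1) : Fp × absoluteGaloisGroup K), (hmem _).mpr rfl,
      ((FreeProPRankTwo.b p, 1) : Fp × absoluteGaloisGroup K), (hmem _).mpr rfl, fun h => ?_⟩
    exact FreeProPRankTwo.a_mul_b_ne_b_mul_a p (congrArg Prod.fst h)
  · obtain ⟨j, hj⟩ := exists_surjective_toGeom_split Fp K
    exact (IsProSigmaCompletion.isTopologicallyFinitelyGenerated_of_fg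
      (FreeProPRankTwo.isProSigmaCompletion_ι p)).of_surjective j hj

end Instances

end FundamentalExtension

end Literature.AnabelianGeometry.AbsoluteAnabelian

end
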